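import Mathlib.Analysis.Convex.Integral
import Literature.Geometry.Kaehler.ComplexTorusHodge
import Literature.Analysis.Complex.PQTypes
import HarnessLib

/-!
# The Hodge decomposition of a complex torus (Lange–Birkenhake 1992, §1.1.5)

Companion of `Literature/Geometry/Kaehler/ComplexTorusHodge.lean`, which proves
Lange–Birkenhake's Prop. 1.1.20 with complex coefficients — `ComplexTorus.cconstClassEquiv Φ :
Alt^k_ℝ(E; ℂ) ≃ₗ[ℂ] H^k_dR(X; ℂ)`, every class of the complex torus `X = E/Φ(ℤ^ι)` is the class of
a unique invariant form, its average — and the inclusion `IF^{p,q}(X) ⊆ H^{p,q}(X)`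
(`ComplexTorus.cconstClass_mem_hodgePQ`). Here the **Hodge decomposition of the torus** is
PROVED, for the tree's `hodgePQ E X k p q ⊆ H^k_dR(X; ℂ)` (the span of the classes of closed
forms of type `(p,q)`, file `Literature/NumberTheory/Transcendental/ComplexForms.lean`):

* `Literature.Analysis.Complex.isInternal_typeSubmodule`: pointwise,
  `Alt^k_ℝ(E; ℂ) = ⨁_{p+q=k} Λ^{p,q}` (`typeSubmodule`, file `Literature/Analysis/Complex/PQTypes.lean`)
  — Lange–Birkenhake's "`IF^n(X) = ⨁_{p+q=n} IF^{p,q}(X)`" (§1.1.5, PDF p. 25), from the tree's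
  discharged type calculus (`sum_antidiagonal_typeComponent_holds`, `isOfTypeAt_typeProjAt`,
  `IsOfTypeAt.typeProjAt_of_ne`);
* `ComplexTorus.hodgePQ_eq_map_typeSubmodule`: **`H^{p,q}(X)` is exactly the set of classes of
  the invariant forms of type `(p,q)`**, `hodgePQ E X k p q = cconstClass Φ (Λ^{p,q})` — the
  average of a closed `(p,q)`-form is an invariant `(p,q)`-form (`ComplexTorus.avg_mem_typeSubmodule`:
  `Λ^{p,q}` is a closed subspace, `isClosed_typeSubmodule`, and the normalised Haar measure is a
  probability measure, so `Convex.integral_mem` applies);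
* `ComplexTorus.isInternal_hodgePQ`: **`H^k_dR(X; ℂ) = ⨁_{p+q=k} H^{p,q}(X)`**
  (`DirectSum.IsInternal`), Lange–Birkenhake (1992), §1.1.5 Prop. 1.1.23
  ("`Hⁿ(X, ℂ) ≃ ⨁_{p+q=n} IF^{p,q}(X) ≃ ⨁_{p+q=n} ⋀ᵖΩ ⊗ ⋀^q Ω̄`", PDF p. 26; with Remark 1.1.24 and
  Voisin (2002), §6.1.3 Prop. 6.11, `IF^{p,q} = K^{p,q}` = the tree's `hodgePQ`), transported from
  the pointwise statement along the order isomorphism of submodule lattices induced by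
  `cconstClassEquiv`. It has verbatim the shape of the field `isInternal_hodgePQ` of
  `HodgeTheory.HodgeModel` and of the body of the tree's named fact hodge.S07
  (`Literature.AlgebraicGeometry.Motives.isInternal_hodgePQ`, stated for compact Kähler manifolds;
  the one-line specialisation to `M = ComplexTorus Φ` is left to the consumer so that this file
  does not import `Motives/HodgeDecomposition`).

Consumer: the `HodgeTheory.HodgeModel` whose carrier is a complex
torus (e.g. `E_τ × E_τ × E_τ`, `(E_τ³)^an = ℂ³/(ℤ + τℤ)³`, the threefold of Grothendieck (1969),
`Literature/Barriers/HodgeConjecture/GeneralizedHodgeTrivialReasonsFiltOne.lean`). No definition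
and no named fact is introduced; nothing here is deep ("in the case of a complex torus it is
considerably easier than for a general compact Kähler manifold", Lange–Birkenhake p. 24).

## References

* H. Lange, Ch. Birkenhake, *Complex Abelian Varieties*, Grundlehren 302 (1992), §1.1.4
  Prop. 1.1.20, §1.1.5 Thm. 1.1.21, Prop. 1.1.23, Remark 1.1.24 (held copy, PDF pp. 24–26).
  [LangeBirkenhake1992]
* C. Voisin, *Hodge Theory and Complex Algebraic Geometry I* (2002), §2.3.1 eq. (2.4), §6.1.3
  Prop. 6.11. [Voisin2002]
-/

noncomputable section

open scoped Manifold ContDiff Topology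
open Bundle Set Finset MeasureTheory
open Literature.NumberTheory.Transcendental

/-! ### Pointwise: `Alt^k_ℝ(E; ℂ) = ⨁_{p+q=k} Λ^{p,q}` -/

namespace Literature.Analysis.Complex

open Literature.Geometry.Kaehler

variable {E : Type*} [NormedAddCommGroup E] [NormedSpace ℂ E] {k : ℕ}

/-- **Pointwise type decomposition**: an alternating `k`-form is the sum of its
`(p,q)`-components, `η = ∑_{p+q=k} η^{p,q}` (the tree's discharged fact
`sum_antidiagonal_typeComponent` read on the constant form `x ↦ η`).
[cite: Voisin2002, §2.3.1 eq. (2.4)] -/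
theorem sum_antidiagonal_typeProjAt (η : E [⋀^Fin k]→L[ℝ] ℂ) :
    ∑ pq ∈ antidiagonal k, typeProjAt pq.1 pq.2 η = η := by
  have h := sum_antidiagonal_typeComponent_holds (E := E) (M := E) (k := k)
    (fun _ : E ↦ η : MForm 𝓘(ℝ, E) E ℂ k)
  simp only [typeComponent_const] at h
  have h0 := congr_fun h (0 : E)
  have h1 := Finset.sum_apply (0 : E) (antidiagonal k)
    (fun pq : ℕ × ℕ ↦ (fun _ : E ↦ typeProjAt (E := E) pq.1 pq.2 η : MForm 𝓘(ℝ, E) E ℂ k))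
  exact h1.symm.trans h0

/-- **The type subspaces `Λ^{p,q}`, `p + q = k`, are independent**: the projection `typeProjₗ p q`
is the identity on `Λ^{p,q}` and kills every `Λ^{p',q'}`, `(p',q') ≠ (p,q)`.
[cite: Voisin2002, §2.3.1 eq. (2.4)] -/
theorem iSupIndep_typeSubmodule :
    iSupIndep fun pq : ↥(antidiagonal k) ↦ typeSubmodule E k pq.1.1 pq.1.2 := by
  refine iSupIndep_def.2 fun i ↦ (Submodule.disjoint_def.2 fun x hx hx' ↦ ?_)
  have hker : (⨆ (j : ↥(antidiagonal k)) (_ : j ≠ i), typeSubmodule E k j.1.1 j.1.2) ≤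
      LinearMap.ker (typeProjₗ (E := E) (k := k) i.1.1 i.1.2) := by
    refine iSup₂_le fun j hj ↦ fun y hy ↦ ?_
    rw [LinearMap.mem_ker, typeProjₗ_apply]
    have hj' : j.1.1 + j.1.2 = k := mem_antidiagonal.1 j.2
    have hne : j.1.1 ≠ i.1.1 ∨ j.1.2 ≠ i.1.2 := by
      rcases ne_or_eq j.1.1 i.1.1 with h | h
      · exact Or.inl h
      · exact Or.inr fun h' ↦ hj (Subtype.ext (Prod.ext h h'))
    exact (isOfTypeAt_of_mem_typeSubmodule hj' hy).typeProjAt_of_ne hne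
  have h1 : typeProjAt i.1.1 i.1.2 x = x := mem_typeSubmodule_iff.1 hx
  have h2 : typeProjAt i.1.1 i.1.2 x = 0 := by
    simpa only [LinearMap.mem_ker, typeProjₗ_apply] using hker hx'
  rw [← h1, h2]

/-- **The type subspaces `Λ^{p,q}`, `p + q = k`, span `Alt^k_ℝ(E; ℂ)`.**
[cite: Voisin2002, §2.3.1 eq. (2.4)] -/
theorem iSup_typeSubmodule_eq_top :
    ⨆ pq : ↥(antidiagonal k), typeSubmodule E k pq.1.1 pq.1.2 = ⊤ := by
  refine eq_top_iff.2 fun η _ ↦ ?_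
  rw [← sum_antidiagonal_typeProjAt η]
  refine Submodule.sum_mem _ fun pq hpq ↦ ?_
  have h : pq.1 + pq.2 = k := mem_antidiagonal.1 hpq
  exact Submodule.mem_iSup_of_mem (⟨pq, hpq⟩ : ↥(antidiagonal k))
    ((isOfTypeAt_typeProjAt h η).mem_typeSubmodule)

/-- **`Alt^k_ℝ(E; ℂ) = ⨁_{p+q=k} Λ^{p,q}`** as an internal direct sum (Lange–Birkenhake (1992),
§1.1.5: "`IF^n(X) = ⨁_{p+q=n} IF^{p,q}(X)`", for the invariant forms of a complex torus `X = V/Λ`,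
`IF^n(X) ≅ Alt^n_ℝ(V; ℂ)`; Voisin (2002), §2.3.1 eq. (2.4)).
[cite: LangeBirkenhake1992, §1.1.5 (PDF p. 25)] [cite: Voisin2002, §2.3.1 eq. (2.4)] -/
theorem isInternal_typeSubmodule :
    DirectSum.IsInternal fun pq : ↥(antidiagonal k) ↦ typeSubmodule E k pq.1.1 pq.1.2 :=
  DirectSum.isInternal_submodule_of_iSupIndep_of_iSup_eq_top iSupIndep_typeSubmodule
    iSup_typeSubmodule_eq_top

end Literature.Analysis.Complex

/-! ### The complex torus -/

namespace Literature.Geometry.Kaehler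

namespace ComplexTorus

open Literature.Analysis.Complex

variable {ι : Type*} [Fintype ι] {E : Type*} [NormedAddCommGroup E] [NormedSpace ℂ E]
  (Φ : (ι → ℝ) ≃L[ℝ] E) {k : ℕ}

/-- On the torus (trivial tangent bundle `T_x X = E`) the tree's type component is computed
pointwise by the flat projection: `(α^{p,q})(x) = (α(x))^{p,q}`. [folklore] -/
theorem typeComponent_apply_eq_typeProjAt (p q : ℕ) (α : MForm 𝓘(ℝ, E) (ComplexTorus Φ) ℂ k)
    (x : ComplexTorus Φ) :
    (α.typeComponent p q x : E [⋀^Fin k]→L[ℝ] ℂ) = typeProjAt (E := E) p q (α x) := by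
  unfold typeProjAt MForm.typeComponent MForm.weightComponent tangentRotate
  split_ifs <;> rfl

/-- The `(p,q)`-component of an invariant form is the invariant form with value the
`(p,q)`-component of its value. [cite: LangeBirkenhake1992, §1.1.5 (PDF p. 25)] -/
theorem typeComponent_constForm (p q : ℕ) (c : E [⋀^Fin k]→L[ℝ] ℂ) :
    (constForm Φ c).typeComponent p q = constForm Φ (typeProjAt p q c) := by
  funext x
  exact typeComponent_apply_eq_typeProjAt Φ p q (constForm Φ c) x

omit [Fintype ι] in
/-- `IsConstOfType` (file `ComplexTorusHodge`) is the pointwise type `IsOfTypeAt` of `PQTypes`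
(same formula). [folklore] -/
theorem isConstOfType_iff_isOfTypeAt {p q : ℕ} (c : E [⋀^Fin k]→L[ℝ] ℂ) :
    IsConstOfType (E := E) p q c ↔ IsOfTypeAt p q c :=
  Iff.rfl

/-- The values of a form of type `(p,q)` on the torus lie in `Λ^{p,q}`. [cite: Voisin2002, §2.3.1] -/
theorem val_mem_typeSubmodule {p q : ℕ} {α : MForm 𝓘(ℝ, E) (ComplexTorus Φ) ℂ k}
    (hα : IsOfType p q α) (x : ComplexTorus Φ) : val Φ α x ∈ typeSubmodule E k p q :=
  IsOfTypeAt.mem_typeSubmodule ⟨hα.1, fun θ v ↦ hα.2 x θ v⟩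

/-- **The average of a form of type `(p,q)` is an invariant form of type `(p,q)`**: `Λ^{p,q}` is
a closed subspace of `Alt^k_ℝ(E; ℂ)` (`isClosed_typeSubmodule`) containing all values of the form,
and the normalised Haar measure of the torus is a probability measure (`Convex.integral_mem`;
a non-integrable field has average `0 ∈ Λ^{p,q}`). Lange–Birkenhake (1992), §1.1.5 with
Remark 1.1.24. [cite: LangeBirkenhake1992, §1.1.5 (PDF pp. 25–26)] -/
theorem avg_mem_typeSubmodule {p q : ℕ} {α : MForm 𝓘(ℝ, E) (ComplexTorus Φ) ℂ k}
    (hα : IsOfType p q α) : avg Φ α ∈ typeSubmodule E k p q := by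
  by_cases hint : Integrable (val Φ α)
  · rw [avg_def]
    have hconv : Convex ℝ (typeSubmodule E k p q : Set (E [⋀^Fin k]→L[ℝ] ℂ)) :=
      ((typeSubmodule E k p q).restrictScalars ℝ).convex
    exact hconv.integral_mem (isClosed_typeSubmodule p q)
      (Filter.Eventually.of_forall fun x ↦ val_mem_typeSubmodule Φ hα x) hint
  · rw [avg_def, integral_undef hint]
    exact Submodule.zero_mem _

/-- The average of every class of `H^{p,q}(X)` is an invariant form of type `(p,q)` (span
induction from `avg_mem_typeSubmodule`). [cite: LangeBirkenhake1992, §1.1.5 (PDF pp. 25–26)] -/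
theorem cavgClass_mem_typeSubmodule {p q : ℕ} {c : complexDeRhamCohomology E (ComplexTorus Φ) k}
    (hc : c ∈ hodgePQ E (ComplexTorus Φ) k p q) : cavgClass Φ c ∈ typeSubmodule E k p q := by
  induction hc using Submodule.span_induction with
  | mem x hx =>
    obtain ⟨α, hα, rfl⟩ := hx
    rw [cavgClass_mk]
    exact avg_mem_typeSubmodule Φ hα
  | zero => simp
  | add x y _ _ hx hy => simpa only [map_add] using add_mem hx hy
  | smul a x _ hx => simpa only [map_smul] using Submodule.smul_mem _ a hx

variable [FiniteDimensional ℂ E]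

/-- **Lange–Birkenhake (1992), Thm. 1.1.21 / Prop. 1.1.23 for the tree's `hodgePQ`:
`H^{p,q}(X)` is exactly the space of classes of invariant forms of type `(p,q)`,**
`hodgePQ E X k p q = cconstClass Φ (Λ^{p,q})` (for `p + q ≠ k` both sides are `0`). `⊆`: a class
in `H^{p,q}` is the class of its average (`cconstClass_cavgClass`), an invariant `(p,q)`-form
(`cavgClass_mem_typeSubmodule`); `⊇`: `cconstClass_mem_hodgePQ`.
[cite: LangeBirkenhake1992, §1.1.5 Prop. 1.1.23 (PDF p. 26)] [cite: Voisin2002, §6.1.3 Prop. 6.11] -/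
theorem hodgePQ_eq_map_typeSubmodule (p q : ℕ) :
    hodgePQ E (ComplexTorus Φ) k p q = (typeSubmodule E k p q).map (cconstClass Φ) := by
  refine le_antisymm (fun c hc ↦ ?_) (Submodule.map_le_iff_le_comap.2 fun x hx ↦ ?_)
  · exact ⟨cavgClass Φ c, cavgClass_mem_typeSubmodule Φ hc, cconstClass_cavgClass Φ c⟩
  · rw [Submodule.mem_comap]
    by_cases hpq : p + q = k
    · exact cconstClass_mem_hodgePQ Φ
        ((isConstOfType_iff_isOfTypeAt x).2 (isOfTypeAt_of_mem_typeSubmodule hpq hx))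
    · have hx0 : x = 0 := by rw [← mem_typeSubmodule_iff.1 hx, typeProjAt_of_ne hpq]
      rw [hx0, map_zero]
      exact Submodule.zero_mem _

/-- The linear map underlying `cconstClassEquiv` is `cconstClass`. [folklore] -/
theorem coe_cconstClassEquiv :
    ((cconstClassEquiv Φ (k := k) : (E [⋀^Fin k]→L[ℝ] ℂ) ≃ₗ[ℂ] _) :
      (E [⋀^Fin k]→L[ℝ] ℂ) →ₗ[ℂ] complexDeRhamCohomology E (ComplexTorus Φ) k) = cconstClass Φ :=
  rfl

/-- The Hodge pieces of the torus are the images of the type subspaces under the order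
isomorphism of submodule lattices induced by `cconstClassEquiv` (Prop. 1.1.20).
[cite: LangeBirkenhake1992, §1.1.5 Prop. 1.1.23 (PDF p. 26)] -/
theorem hodgePQ_eq_orderIsoMapComap (k : ℕ) :
    (fun pq : ↥(antidiagonal k) ↦ hodgePQ E (ComplexTorus Φ) k pq.1.1 pq.1.2) =
      Submodule.orderIsoMapComap (cconstClassEquiv Φ (k := k)) ∘
        fun pq : ↥(antidiagonal k) ↦ typeSubmodule E k pq.1.1 pq.1.2 := by
  funext pq
  rw [Function.comp_apply, Submodule.orderIsoMapComap_apply, coe_cconstClassEquiv]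
  exact hodgePQ_eq_map_typeSubmodule Φ pq.1.1 pq.1.2

/-- **The Hodge decomposition of a complex torus** (Lange–Birkenhake (1992), §1.1.5
Thm. 1.1.21 / Prop. 1.1.23: "`Hⁿ(X, ℂ) ≃ ⨁_{p+q=n} IF^{p,q}(X) ≃ ⨁_{p+q=n} ⋀ᵖΩ ⊗ ⋀^qΩ̄`"; Remark
1.1.24: the `IF^{p,q}` are the harmonic forms for a flat Kähler metric, so these are the Hodge
pieces `K^{p,q} = H^{p,q}` of Voisin (2002), Prop. 6.11, i.e. the tree's `hodgePQ`): for the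
complex torus `X = E/Φ(ℤ^ι)` and every `k`, the subspaces `H^{p,q}(X) ⊆ H^k_dR(X; ℂ)`,
`p + q = k`, form an internal direct sum decomposition. Proof: `Alt^k_ℝ(E; ℂ) = ⨁ Λ^{p,q}`
(`isInternal_typeSubmodule`) transported along `cconstClassEquiv` (`hodgePQ_eq_orderIsoMapComap`).
[cite: LangeBirkenhake1992, §1.1.5 Thm. 1.1.21 and Prop. 1.1.23 (PDF pp. 24–26)]
[cite: Voisin2002, §6.1.3 Prop. 6.11] -/
theorem isInternal_hodgePQ (k : ℕ) :
    DirectSum.IsInternal fun pq : ↥(antidiagonal k) ↦ hodgePQ E (ComplexTorus Φ) k pq.1.1 pq.1.2 := by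
  refine DirectSum.isInternal_submodule_of_iSupIndep_of_iSup_eq_top ?_ ?_
  · rw [hodgePQ_eq_orderIsoMapComap Φ k, iSupIndep_map_orderIso_iff]
    exact iSupIndep_typeSubmodule
  · rw [hodgePQ_eq_orderIsoMapComap Φ k]
    change ⨆ pq : ↥(antidiagonal k),
      Submodule.orderIsoMapComap (cconstClassEquiv Φ (k := k)) (typeSubmodule E k pq.1.1 pq.1.2) = ⊤
    rw [← OrderIso.map_iSup, iSup_typeSubmodule_eq_top, OrderIso.map_top]

/-- The Hodge decomposition of the torus, spanning half in `Finset`-indexed form: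
`⨆_{p+q=k} H^{p,q}(X) = H^k_dR(X; ℂ)`. [cite: LangeBirkenhake1992, §1.1.5 Prop. 1.1.23 (PDF p. 26)] -/
theorem iSup_hodgePQ_eq_top (k : ℕ) :
    ⨆ pq ∈ antidiagonal k, hodgePQ E (ComplexTorus Φ) k pq.1 pq.2 = ⊤ := by
  rw [← (isInternal_hodgePQ Φ k).submodule_iSup_eq_top, iSup_subtype']

/-- A class lying in two different Hodge pieces of the torus is zero (independence half, read
on averages: an invariant form of two different types vanishes).
[cite: LangeBirkenhake1992, §1.1.5 Prop. 1.1.23 (PDF p. 26)] -/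
theorem eq_zero_of_mem_hodgePQ_of_ne {k p q p' q' : ℕ} (hpq : p + q = k) (hpq' : p' + q' = k)
    (hne : (p, q) ≠ (p', q')) {c : complexDeRhamCohomology E (ComplexTorus Φ) k}
    (hc : c ∈ hodgePQ E (ComplexTorus Φ) k p q) (hc' : c ∈ hodgePQ E (ComplexTorus Φ) k p' q') :
    c = 0 := by
  have h1 := isOfTypeAt_of_mem_typeSubmodule hpq (cavgClass_mem_typeSubmodule Φ hc)
  have h2 := isOfTypeAt_of_mem_typeSubmodule hpq' (cavgClass_mem_typeSubmodule Φ hc')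
  have hne' : p ≠ p' ∨ q ≠ q' := by
    rcases ne_or_eq p p' with h | h
    · exact Or.inl h
    · exact Or.inr fun h' ↦ hne (Prod.ext h h')
  have h0 : cavgClass Φ c = 0 := h1.eq_zero_of_isOfTypeAt_of_ne h2 hne'
  rw [← cconstClass_cavgClass Φ c, h0, map_zero]

end ComplexTorus

end Literature.Geometry.Kaehler

end
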